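import Literature.Probability.LatticeModels.FermionicObservable
import Literature.Probability.LatticeModels.MedialExplorationChains
import Literature.Probability.Percolation.LatticeTraceGeometry
import Literature.Probability.Percolation.PlanarDuality
import Literature.Topology.PlaneTopology.ArgumentIncrement
import HarnessLib

/-!
# The perturbed medial polygon: a corner-avoiding realisation of medial darts

Topic: Probability / LatticeModels (companion to `MedialInterface.lean`,
`MedialExplorationChains.lean`). The exploration polygon of `MedialInterface.lean` runs through
the midpoints of the lattice edges it visits, so it *touches itself* at the midpoint of every
edge visited from both sides (an open edge followed on both sides, a closed edge crossed around
both endpoints). For the planar-topological part of the multiple-crossing estimate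
(`Literature.Probability.Percolation.bondExploration_traversalBound`) we replace each dart by a slightly shifted
straight piece, in lattice units (mesh `1`; faces indexed by lower-left corners, `IsCorner`):

* `dartPt v f i`: the point of the side of the face `f` at its corner `v` in direction `i`,
  moved from the midpoint by `1/8` towards `v` and by `1/8` into `f`; the **dart piece**
  `dartSeg v f = [dartPt v f 0, dartPt v f 1]` replaces the diagonal between the two midpoints.
  Consecutive dart pieces of an exploration are joined by **connectors**
  `[dartPt v₁ f₁ i, dartPt v₂ f₂ i]`: across the crossed (closed) edge when the path turns
  around a vertex (`v₁ = v₂`), along the followed (open) edge inside the face when it turns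
  inside a face (`f₁ = f₂`); their directions and shapes are pinned down in `vertexTurn_dirs`,
  `faceTurn_dirs`, `vConn_shape` (`VConnShape`), `fConn_shape` (`FConnShape`).
* Test sets: the half-diagonal `halfDiag v f = [v, centre of f]` (joining the "left point" `v`
  to the "right point" of the dart `(v, f)`), lattice edges `edgeTrace s(u, w) = [u, w]` (`AnnulusCircuits.lean`),
  centre-to-centre segments `centerSeg f g` of adjacent faces, closed faces `closedSq g`.

Proved (elementary coordinate geometry, all in `(1/8)ℤ`-arithmetic): every piece other than
`dartSeg v f` misses `halfDiag v f` (`eq_of_dartSeg_inter_halfDiag`,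
`VConnShape.not_mem_halfDiag`, `FConnShape.not_mem_halfDiag`), while `dartSeg v f` crosses
it once transversally with crossing defect `±2πi` (`crossInc_dartSeg_ne_zero`,
`crossInc_smul_dartSeg_ne_zero`, via `ArgumentIncrement.lean`); dart pieces and face
connectors miss all lattice edges and dart pieces and vertex connectors all centre segments
(`dartSeg_inter_edgeTrace`, `FConnShape.not_mem_edgeTrace`, `dartSeg_inter_centerSeg`,
`VConnShape.not_mem_centerSeg`); a vertex connector meets a lattice edge only if it is the
crossed edge (`VConnShape.edge_eq`); a face connector meets a centre segment only if it runs
along the common side (`FConnShape.centerSeg_faces`); pieces meet a closed face only if it is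
one of their own faces (`eq_of_dartSeg_inter_closedSq`, `VConnShape.closedSq_faces`,
`FConnShape.closedSq_face`). These are the "free segment" facts behind the side components
in the multiple-crossing estimate. No probability here; everything is folklore planar
bookkeeping for Smirnov's exploration path (Smirnov 2001, §2; Camia–Newman 2007, §2, where
the exploration path is drawn as a polygon strictly between the hexagon centres).
-/

noncomputable section

open Set Complex

namespace Literature.Probability.LatticeModels

/-! ### Coordinates (`coordVec` of `LatticeTraceGeometry.lean`) -/

/-- Coordinates of a difference. [folklore] -/
theorem coordVec_sub (z w : ℂ) (k : Fin 2) : Percolation.coordVec (z - w) k = Percolation.coordVec z k - Percolation.coordVec w k := by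
  fin_cases k <;> simp [Percolation.coordVec]

/-- **Segments in coordinates**: `z ∈ [P, Q]` iff `z = P + t (Q - P)` coordinatewise for some
`t ∈ [0, 1]`. [folklore] -/
theorem mem_segment_iff_coordVec {P Q z : ℂ} :
    z ∈ segment ℝ P Q ↔
      ∃ t : ℝ, 0 ≤ t ∧ t ≤ 1 ∧ ∀ k, Percolation.coordVec z k = Percolation.coordVec P k + t * (Percolation.coordVec Q k - Percolation.coordVec P k) := by
  rw [segment_eq_image']
  constructor
  · rintro ⟨t, ⟨ht0, ht1⟩, rfl⟩
    refine ⟨t, ht0, ht1, fun k => ?_⟩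
    rw [Percolation.coordVec_add, Percolation.coordVec_smul, coordVec_sub]
  · rintro ⟨t, ht0, ht1, h⟩
    refine ⟨t, ⟨ht0, ht1⟩, Percolation.eq_of_coordVec_eq fun k => ?_⟩
    rw [Percolation.coordVec_add, Percolation.coordVec_smul, coordVec_sub, h k]

/-- **Open segments in coordinates.** [folklore] -/
theorem mem_openSegment_iff_coordVec {P Q z : ℂ} :
    z ∈ openSegment ℝ P Q ↔
      ∃ t : ℝ, 0 < t ∧ t < 1 ∧ ∀ k, Percolation.coordVec z k = Percolation.coordVec P k + t * (Percolation.coordVec Q k - Percolation.coordVec P k) := by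
  rw [openSegment_eq_image']
  constructor
  · rintro ⟨t, ⟨ht0, ht1⟩, rfl⟩
    refine ⟨t, ht0, ht1, fun k => ?_⟩
    rw [Percolation.coordVec_add, Percolation.coordVec_smul, coordVec_sub]
  · rintro ⟨t, ht0, ht1, h⟩
    refine ⟨t, ⟨ht0, ht1⟩, Percolation.eq_of_coordVec_eq fun k => ?_⟩
    rw [Percolation.coordVec_add, Percolation.coordVec_smul, coordVec_sub, h k]

/-- In `Fin 2`, the index other than `i`, with the case split `k = i ∨ k = j`. [folklore] -/
theorem fin_two_cases_of_ne {i j : Fin 2} (hji : j ≠ i) (k : Fin 2) : k = i ∨ k = j := by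
  fin_cases i <;> fin_cases j <;> fin_cases k <;> simp_all

/-- Every index of `Fin 2` is `0` or `1`. [folklore] -/
theorem fin_two_eq_zero_or_one (k : Fin 2) : k = 0 ∨ k = 1 := by
  fin_cases k <;> simp

/-- Integers are not strictly between consecutive integers (real form, for `linarith`).
[folklore] -/
private theorem int_le_or_add_one_le (a b : ℤ) : (a : ℝ) ≤ b ∨ (b : ℝ) + 1 ≤ a := by
  rcases le_or_gt a b with h | h
  · exact Or.inl (by exact_mod_cast h)
  · exact Or.inr (by exact_mod_cast h)

/-- Trichotomy of integers with unit gaps (real form, for `linarith`). [folklore] -/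
private theorem int_trichotomy (a b : ℤ) : (a : ℝ) + 1 ≤ b ∨ (a = b ∧ (a : ℝ) = b) ∨ (b : ℝ) + 1 ≤ a := by
  rcases lt_trichotomy a b with h | h | h
  · exact Or.inl (by exact_mod_cast h)
  · exact Or.inr (Or.inl ⟨h, by rw [h]⟩)
  · exact Or.inr (Or.inr (by exact_mod_cast h))

/-- The two possible values of a corner coordinate (real form). [folklore] -/
theorem IsCorner.coord_cases {v f : Site 2} (hv : IsCorner v f) (k : Fin 2) :
    (v k = f k ∧ (v k : ℝ) = f k) ∨ (v k = f k + 1 ∧ (v k : ℝ) = f k + 1) := by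
  rcases hv k with h | h
  · exact Or.inl ⟨h, by exact_mod_cast h⟩
  · exact Or.inr ⟨h, by exact_mod_cast h⟩

/-! ### Faces, dart pieces and test sets (lattice units) -/

/-- The centre `faceCenter f = f + (1 + i)/2` of the face `f` (`FermionicObservable.lean`) in
coordinates: `(f 0 + 1/2, f 1 + 1/2)`. [folklore] -/
theorem faceCenter_eq (f : Site 2) : faceCenter f = ⟨f 0 + 1 / 2, f 1 + 1 / 2⟩ := by
  apply Complex.ext <;> simp [faceCenter]

/-- Coordinates of the face centre. [folklore] -/
@[simp] theorem coordVec_faceCenter (f : Site 2) (k : Fin 2) : Percolation.coordVec (faceCenter f) k = f k + 1 / 2 := by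
  rw [faceCenter_eq]; fin_cases k <;> simp [Percolation.coordVec]

/-- The open face `f`: the open unit square with lower-left corner `f`. [folklore] -/
def openSq (f : Site 2) : Set ℂ := {z | ∀ k, (f k : ℝ) < Percolation.coordVec z k ∧ Percolation.coordVec z k < f k + 1}

/-- The closed face `f`. [folklore] -/
def closedSq (f : Site 2) : Set ℂ := {z | ∀ k, (f k : ℝ) ≤ Percolation.coordVec z k ∧ Percolation.coordVec z k ≤ f k + 1}

/-- The offset, from the lower side of `f` in direction `k`, of the shifted midpoint of the side
at the corner `v`: `3/8` if `v` is on the lower side in direction `k`, `5/8` otherwise (the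
midpoint `1/2` moved by `1/8` towards `v`). [folklore] -/
def toward (v f : Site 2) (k : Fin 2) : ℝ := if v k = f k then 3 / 8 else 5 / 8

/-- The offset, from the lower side of `f` in direction `k`, of a point at distance `1/8` inside
`f` from the side through `v` orthogonal to `k`: `1/8` or `7/8`. [folklore] -/
def inward (v f : Site 2) (k : Fin 2) : ℝ := if v k = f k then 1 / 8 else 7 / 8

/-- **The shifted side point** of the dart `(v, f)` in direction `i`: on the side of `f` at `v`
in direction `i`, at offset `toward v f i` along `i` (i.e. `1/8` from the midpoint towards `v`)
and `inward v f j` across (i.e. `1/8` inside `f`). [folklore] -/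
def dartPt (v f : Site 2) (i : Fin 2) : ℂ :=
  if i = 0 then ⟨f 0 + toward v f 0, f 1 + inward v f 1⟩ else ⟨f 0 + inward v f 0, f 1 + toward v f 1⟩

/-- The coordinate of `dartPt v f i` along `i`. [folklore] -/
theorem coordVec_dartPt_self (v f : Site 2) (i : Fin 2) : Percolation.coordVec (dartPt v f i) i = f i + toward v f i := by
  fin_cases i <;> simp [Percolation.coordVec, dartPt]

/-- The coordinate of `dartPt v f i` across `i`. [folklore] -/
theorem coordVec_dartPt_of_ne (v f : Site 2) {i k : Fin 2} (h : k ≠ i) :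
    Percolation.coordVec (dartPt v f i) k = f k + inward v f k := by
  fin_cases i <;> fin_cases k <;> simp_all [Percolation.coordVec, dartPt]

/-- **The dart piece** of the corner `(v, f)`: the segment between its two shifted side points
(the corner diagonal of `f` at `v`, pushed by `1/8` towards `v` along the sides and by `1/8`
into `f`). [folklore] -/
def dartSeg (v f : Site 2) : Set ℂ := segment ℝ (dartPt v f 0) (dartPt v f 1)

/-- **The half-diagonal** of the corner `(v, f)`: the segment from the vertex `v` (the point
"just left" of the dart) to the centre of `f` (the point "just right" of it). [folklore] -/
def halfDiag (v f : Site 2) : Set ℂ := segment ℝ (Site.toComplex v) (faceCenter f)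

/-- The centre-to-centre segment of two faces (the geometric dual edge when they are adjacent).
[folklore] -/
def centerSeg (f g : Site 2) : Set ℂ := segment ℝ (faceCenter f) (faceCenter g)

/-! ### Coordinate descriptions of the pieces -/

/-- **Coordinates along a dart piece**: in each direction `k` the piece stays at offset in
`[1/8, 3/8]` from the side of `f` through `v` (offsets `[1/8, 3/8]` if `v k = f k`,
`[5/8, 7/8]` if `v k = f k + 1`). [folklore] -/
theorem dartSeg_coord {v f : Site 2} {z : ℂ} (hz : z ∈ dartSeg v f) (k : Fin 2) :
    (v k = f k → (f k : ℝ) + 1 / 8 ≤ Percolation.coordVec z k ∧ Percolation.coordVec z k ≤ f k + 3 / 8) ∧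
      (v k = f k + 1 → (f k : ℝ) + 5 / 8 ≤ Percolation.coordVec z k ∧ Percolation.coordVec z k ≤ f k + 7 / 8) := by
  rw [dartSeg, mem_segment_iff_coordVec] at hz
  obtain ⟨t, ht0, ht1, h⟩ := hz
  have hk := h k
  rcases fin_two_eq_zero_or_one k with rfl | rfl
  · rw [coordVec_dartPt_self, coordVec_dartPt_of_ne _ _ (show (0 : Fin 2) ≠ 1 by decide)] at hk
    constructor
    · intro h0
      simp only [toward, inward, h0, if_true] at hk
      constructor <;> nlinarith
    · intro h0
      have h0' : ¬ v 0 = f 0 := by omega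
      simp only [toward, inward, h0', if_false] at hk
      constructor <;> nlinarith
  · rw [coordVec_dartPt_of_ne _ _ (show (1 : Fin 2) ≠ 0 by decide), coordVec_dartPt_self] at hk
    constructor
    · intro h1
      simp only [toward, inward, h1, if_true] at hk
      constructor <;> nlinarith
    · intro h1
      have h1' : ¬ v 1 = f 1 := by omega
      simp only [toward, inward, h1', if_false] at hk
      constructor <;> nlinarith

/-- A dart piece lies in its open face. [folklore] -/
theorem dartSeg_subset_openSq {v f : Site 2} (hv : IsCorner v f) : dartSeg v f ⊆ openSq f := by
  intro z hz k
  have h := dartSeg_coord hz k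
  rcases hv k with hk | hk
  · have := h.1 hk; constructor <;> linarith
  · have := h.2 hk; constructor <;> linarith

/-- **No coordinate of a dart piece is an integer or a half-integer**: for every integer `n`,
`coordVec z k - n ∉ {0, 1/2}`; quantitatively, `coordVec z k` is at distance `≥ 1/8` from `n` and
from `n + 1/2`. Stated as the four excluded windows. [folklore] -/
theorem dartSeg_coord_ne {v f : Site 2} (hv : IsCorner v f) {z : ℂ} (hz : z ∈ dartSeg v f)
    (k : Fin 2) (n : ℤ) :
    ¬ ((n : ℝ) - 1 / 8 < Percolation.coordVec z k ∧ Percolation.coordVec z k < n + 1 / 8) ∧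
      ¬ ((n : ℝ) + 3 / 8 < Percolation.coordVec z k ∧ Percolation.coordVec z k < n + 5 / 8) := by
  have h := dartSeg_coord hz k
  rcases hv k with hk | hk
  · obtain ⟨ha, hb⟩ := h.1 hk
    rcases int_trichotomy n (f k) with hn | ⟨-, hn⟩ | hn <;>
      constructor <;> rintro ⟨h1, h2⟩ <;> linarith
  · obtain ⟨ha, hb⟩ := h.2 hk
    rcases int_trichotomy n (f k) with hn | ⟨-, hn⟩ | hn <;>
      constructor <;> rintro ⟨h1, h2⟩ <;> linarith

/-- **Coordinates along the half-diagonal**: `coordVec z k = v k + s (1/2 - (v k - f k))` for one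
`s ∈ [0, 1]`. [folklore] -/
theorem halfDiag_coord {v f : Site 2} {z : ℂ} (hz : z ∈ halfDiag v f) :
    ∃ s : ℝ, 0 ≤ s ∧ s ≤ 1 ∧ ∀ k, Percolation.coordVec z k = v k + s * (f k + 1 / 2 - v k) := by
  rw [halfDiag, mem_segment_iff_coordVec] at hz
  obtain ⟨s, hs0, hs1, h⟩ := hz
  refine ⟨s, hs0, hs1, fun k => ?_⟩
  rw [h k, Percolation.coordVec_toComplex, coordVec_faceCenter]

/-- Coordinates along the half-diagonal of a corner, split by the corner position: offset `s/2`
from the side through `v`. [folklore] -/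
theorem halfDiag_coord_corner {v f : Site 2} (hv : IsCorner v f) {z : ℂ} (hz : z ∈ halfDiag v f) :
    ∃ s : ℝ, 0 ≤ s ∧ s ≤ 1 ∧ ∀ k,
      (v k = f k ∧ Percolation.coordVec z k = f k + s / 2) ∨ (v k = f k + 1 ∧ Percolation.coordVec z k = f k + 1 - s / 2) := by
  obtain ⟨s, hs0, hs1, h⟩ := halfDiag_coord hz
  refine ⟨s, hs0, hs1, fun k => ?_⟩
  rcases hv.coord_cases k with ⟨hk, hk'⟩ | ⟨hk, hk'⟩
  · left; refine ⟨hk, ?_⟩; rw [h k, hk']; ring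
  · right; refine ⟨hk, ?_⟩; rw [h k, hk']; ring

/-- **Coordinates along a centre segment.** [folklore] -/
theorem centerSeg_coord {f g : Site 2} {z : ℂ} (hz : z ∈ centerSeg f g) :
    ∃ s : ℝ, 0 ≤ s ∧ s ≤ 1 ∧ ∀ k, Percolation.coordVec z k = f k + 1 / 2 + s * (g k - f k) := by
  rw [centerSeg, mem_segment_iff_coordVec] at hz
  obtain ⟨s, hs0, hs1, h⟩ := hz
  refine ⟨s, hs0, hs1, fun k => ?_⟩
  rw [h k, coordVec_faceCenter, coordVec_faceCenter]
  ring

/-! ### The half-diagonal against the pieces -/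

/-- **A dart piece meets a half-diagonal only if it is the dart of that corner.** If
`dartSeg v' f'` meets `halfDiag v f` then `v' = v` and `f' = f`: in each coordinate the dart
piece sits at offset in `(0, 1/2)` from the side of `f'` through `v'`, the half-diagonal at
offset in `[0, 1/2]` from the side of `f` through `v`, on the way to the centre; comparing the
two integer parts forces `f' k = f k` and then `v' k = v k`. [folklore] -/
theorem eq_of_dartSeg_inter_halfDiag {v f v' f' : Site 2} (hv : IsCorner v f) (hv' : IsCorner v' f')
    (h : (dartSeg v' f' ∩ halfDiag v f).Nonempty) : v' = v ∧ f' = f := by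
  obtain ⟨z, hz1, hz2⟩ := h
  obtain ⟨s, hs0, hs1, hdiag⟩ := halfDiag_coord_corner hv hz2
  suffices hk : ∀ k, v' k = v k ∧ f' k = f k by
    exact ⟨funext fun k => (hk k).1, funext fun k => (hk k).2⟩
  intro k
  have hd := dartSeg_coord hz1 k
  rcases hdiag k with ⟨hvk, hzk⟩ | ⟨hvk, hzk⟩ <;> rcases hv' k with hvk2 | hvk2
  · obtain ⟨ha, hb⟩ := hd.1 hvk2
    rcases int_trichotomy (f k) (f' k) with hf | ⟨hf, hf'⟩ | hf
    · exfalso; linarith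
    · exact ⟨by omega, by omega⟩
    · exfalso; linarith
  · obtain ⟨ha, hb⟩ := hd.2 hvk2
    rcases int_trichotomy (f k) (f' k) with hf | ⟨hf, hf'⟩ | hf <;> exfalso <;> linarith
  · obtain ⟨ha, hb⟩ := hd.1 hvk2
    rcases int_trichotomy (f k) (f' k) with hf | ⟨hf, hf'⟩ | hf <;> exfalso <;> linarith
  · obtain ⟨ha, hb⟩ := hd.2 hvk2
    rcases int_trichotomy (f k) (f' k) with hf | ⟨hf, hf'⟩ | hf
    · exfalso; linarith
    · exact ⟨by omega, by omega⟩
    · exfalso; linarith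

/-- **Vertex connectors miss every half-diagonal.** A vertex connector has one coordinate
constantly at `3/8` or `5/8 (mod 1)` and the other within `1/8` of an integer; along a
half-diagonal both offsets from `v` are the *same* `s/2 ∈ [0, 1/2]`, and `s/2 ≤ 1/8` across is
incompatible with `s/2 ∈ [3/8, 5/8] + ℤ` along. Here the connector is described by its shape:
constant coordinate `c = a + 3/8` or `a + 5/8` in direction `i` (`a ∈ ℤ`), coordinate in
`[g - 1/8, g + 1/8]` in direction `j` (`g ∈ ℤ`). [folklore] -/
theorem vConnShape_inter_halfDiag {i j : Fin 2} {a g : ℤ} {c : ℝ}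
    (hc : c = a + 3 / 8 ∨ c = a + 5 / 8) {v f : Site 2} (hv : IsCorner v f) {z : ℂ}
    (hzi : Percolation.coordVec z i = c) (hzj : (g : ℝ) - 1 / 8 ≤ Percolation.coordVec z j ∧ Percolation.coordVec z j ≤ g + 1 / 8)
    (hz : z ∈ halfDiag v f) : False := by
  obtain ⟨s, hs0, hs1, hdiag⟩ := halfDiag_coord hz
  have hi := hdiag i
  have hj := hdiag j
  rw [hzi] at hi
  -- across: `s ≤ 1/4`
  have hs : s ≤ 1 / 4 := by
    rcases hv.coord_cases j with ⟨-, hvj⟩ | ⟨-, hvj⟩ <;> rw [hvj] at hj <;>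
      rcases int_trichotomy g (f j) with hg | ⟨-, hg⟩ | hg <;> nlinarith [hzj.1, hzj.2]
  -- along: contradiction
  rcases hv.coord_cases i with ⟨-, hvi⟩ | ⟨-, hvi⟩ <;> rw [hvi] at hi <;>
    rcases hc with hc | hc <;> rw [hc] at hi <;>
    rcases int_trichotomy a (f i) with ha | ⟨-, ha⟩ | ha <;> nlinarith

/-- **Face connectors miss every half-diagonal.** A face connector has one coordinate in
`[3/8, 5/8] (mod 1)` and the other constantly at `1/8` or `7/8 (mod 1)`; along a half-diagonal
the first forces `s/2 ≥ 3/8`, the second `s/2 ∉ (1/8, 7/8) + ℤ`. Shape: coordinate in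
`[a + 3/8, a + 5/8]` in direction `i`, constant `c' = b + 1/8` or `b + 7/8` in direction `j`.
[folklore] -/
theorem fConnShape_inter_halfDiag {i j : Fin 2} {a b : ℤ} {c' : ℝ}
    (hc' : c' = b + 1 / 8 ∨ c' = b + 7 / 8) {v f : Site 2} (hv : IsCorner v f) {z : ℂ}
    (hzi : (a : ℝ) + 3 / 8 ≤ Percolation.coordVec z i ∧ Percolation.coordVec z i ≤ a + 5 / 8) (hzj : Percolation.coordVec z j = c')
    (hz : z ∈ halfDiag v f) : False := by
  obtain ⟨s, hs0, hs1, hdiag⟩ := halfDiag_coord hz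
  have hi := hdiag i
  have hj := hdiag j
  rw [hzj] at hj
  -- along: `3/4 ≤ s`
  have hs : 3 / 4 ≤ s := by
    rcases hv.coord_cases i with ⟨-, hvi⟩ | ⟨-, hvi⟩ <;> rw [hvi] at hi <;>
      rcases int_trichotomy a (f i) with ha | ⟨-, ha⟩ | ha <;> nlinarith [hzi.1, hzi.2]
  -- across: contradiction
  rcases hv.coord_cases j with ⟨-, hvj⟩ | ⟨-, hvj⟩ <;> rw [hvj] at hj <;>
    rcases hc' with hc | hc <;> rw [hc] at hj <;>
    rcases int_trichotomy b (f j) with hb | ⟨-, hb⟩ | hb <;> nlinarith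

/-! ### The dart piece crosses its own half-diagonal once, transversally -/

/-- The side functional of the half-diagonal at the two shifted side points: explicit values
`± 1/8` up to the orientation sign of the corner; in particular they are nonzero and of
opposite signs. [folklore] -/
theorem segSide_halfDiag_dartPt {v f : Site 2} (hv : IsCorner v f) :
    (0 < Literature.Topology.PlaneTopology.segSide (Site.toComplex v) (faceCenter f) (dartPt v f 0) ∧
        Literature.Topology.PlaneTopology.segSide (Site.toComplex v) (faceCenter f) (dartPt v f 1) < 0) ∨
      (Literature.Topology.PlaneTopology.segSide (Site.toComplex v) (faceCenter f) (dartPt v f 0) < 0 ∧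
        0 < Literature.Topology.PlaneTopology.segSide (Site.toComplex v) (faceCenter f) (dartPt v f 1)) := by
  unfold Literature.Topology.PlaneTopology.segSide
  simp only [Complex.mul_im, Complex.sub_re, Complex.sub_im, Complex.conj_re, Complex.conj_im,
    Site.toComplex_re, Site.toComplex_im, faceCenter_eq, dartPt, if_true, toward, inward,
    show (1 : Fin 2) ≠ 0 by decide, if_false]
  rcases hv.coord_cases 0 with ⟨h0, h0'⟩ | ⟨h0, h0'⟩ <;>
    rcases hv.coord_cases 1 with ⟨h1, h1'⟩ | ⟨h1, h1'⟩ <;>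
    simp only [h0, h1, if_true, show ¬ (f 0 + 1 = f 0) by omega, show ¬ (f 1 + 1 = f 1) by omega,
      if_false, Int.cast_add, Int.cast_one] <;>
    first
    | (left; constructor <;> nlinarith)
    | (right; constructor <;> nlinarith)

/-- The dart piece meets the *open* half-diagonal (at its midpoint, the point at offsets
`(1/4, 1/4)` from `v`). [folklore] -/
theorem exists_mem_dartSeg_mem_openSegment {v f : Site 2} (hv : IsCorner v f) :
    ∃ p ∈ dartSeg v f, p ∈ openSegment ℝ (Site.toComplex v) (faceCenter f) := by
  -- the midpoint of the dart piece
  refine ⟨(1 / 2 : ℝ) • dartPt v f 0 + (1 / 2 : ℝ) • dartPt v f 1,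
    ⟨1 / 2, 1 / 2, by norm_num, by norm_num, by norm_num, rfl⟩, ?_⟩
  rw [mem_openSegment_iff_coordVec]
  refine ⟨1 / 2, by norm_num, by norm_num, fun k => ?_⟩
  rw [Percolation.coordVec_add, Percolation.coordVec_smul, Percolation.coordVec_smul, Percolation.coordVec_toComplex, coordVec_faceCenter]
  rcases fin_two_eq_zero_or_one k with rfl | rfl
  · rw [coordVec_dartPt_self, coordVec_dartPt_of_ne _ _ (show (0 : Fin 2) ≠ 1 by decide)]
    simp only [toward, inward]
    rcases hv.coord_cases 0 with ⟨h0, h0'⟩ | ⟨h0, h0'⟩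
    · simp only [h0, if_true]; ring
    · simp only [show ¬ v 0 = f 0 by omega, if_false, h0']; ring
  · rw [coordVec_dartPt_of_ne _ _ (show (1 : Fin 2) ≠ 0 by decide), coordVec_dartPt_self]
    simp only [toward, inward]
    rcases hv.coord_cases 1 with ⟨h1, h1'⟩ | ⟨h1, h1'⟩
    · simp only [h1, if_true]; ring
    · simp only [show ¬ v 1 = f 1 by omega, if_false, h1']; ring

/-- **The dart piece crosses its half-diagonal with defect `±2πi`**: the crossing defect
(`Path.crossInc`, `ArgumentIncrement.lean`) of the straight path along `dartSeg v f` relative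
to the segment `[v, centre f]` is `2πi` or `-2πi`, in particular nonzero. [folklore] -/
theorem crossInc_dartSeg_ne_zero {v f : Site 2} (hv : IsCorner v f) :
    (Path.segment (dartPt v f 0) (dartPt v f 1)).crossInc (Site.toComplex v) (faceCenter f) ≠ 0 := by
  have hx := exists_mem_dartSeg_mem_openSegment hv
  have hpi : (2 * Real.pi * I : ℂ) ≠ 0 := by simp [Real.pi_ne_zero, I_ne_zero]
  rcases segSide_halfDiag_dartPt hv with ⟨h0, h1⟩ | ⟨h0, h1⟩
  · rw [Path.crossInc_segment_of_cross h0 h1 hx]; exact hpi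
  · rw [Path.crossInc_segment_of_cross' h0 h1 hx]; exact neg_ne_zero.2 hpi

/-- The vertex `v` is not on its dart piece. [folklore] -/
theorem toComplex_not_mem_dartSeg {v f : Site 2} (hv : IsCorner v f) : Site.toComplex v ∉ dartSeg v f := by
  intro h
  have := (dartSeg_coord_ne hv h 0 (v 0)).1
  apply this
  simp only [Percolation.coordVec_toComplex]
  constructor <;> linarith

/-- The face centre is not on the dart piece. [folklore] -/
theorem faceCenter_not_mem_dartSeg {v f : Site 2} (hv : IsCorner v f) : faceCenter f ∉ dartSeg v f := by
  intro h
  have := (dartSeg_coord_ne hv h 0 (f 0)).2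
  apply this
  simp only [coordVec_faceCenter]
  constructor <;> linarith

/-! ### Lattice edges, centre segments and closed faces against the pieces -/

/-- From `j ≠ i` in `Fin 2`: after fixing `i`, `j` is determined. [folklore] -/
theorem fin_two_eq_other {i j : Fin 2} (hji : j ≠ i) : (i = 0 ∧ j = 1) ∨ (i = 1 ∧ j = 0) := by
  fin_cases i <;> fin_cases j <;> simp_all

/-- **Dart pieces miss every lattice edge.** A lattice edge has an integer coordinate across,
while both coordinates of a dart piece are at distance `≥ 1/8` from the integers. [folklore] -/
theorem dartSeg_inter_edgeTrace {v f u w : Site 2} (hv : IsCorner v f) (huw : (zdGraph 2).Adj u w)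
    {z : ℂ} (hz : z ∈ dartSeg v f) (hz' : z ∈ Percolation.edgeTrace s(u, w)) : False := by
  rw [Percolation.edgeTrace_mk, mem_segment_iff_coordVec] at hz'
  obtain ⟨s, hs0, hs1, h⟩ := hz'
  simp only [Percolation.coordVec_toComplex] at h
  have h0 := h 0
  have h1 := h 1
  rcases (Percolation.zdGraph_two_adj_iff u w).1 huw with ⟨hw0, hw1⟩ | ⟨hw0, hw1⟩ | ⟨hw1, hw0⟩ | ⟨hw1, hw0⟩
  · have e : (w 1 : ℝ) = u 1 := by exact_mod_cast hw1
    rw [e, sub_self, mul_zero, add_zero] at h1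
    exact (dartSeg_coord_ne hv hz 1 (u 1)).1 ⟨by linarith, by linarith⟩
  · have e : (w 1 : ℝ) = u 1 := by exact_mod_cast hw1
    rw [e, sub_self, mul_zero, add_zero] at h1
    exact (dartSeg_coord_ne hv hz 1 (u 1)).1 ⟨by linarith, by linarith⟩
  · have e : (w 0 : ℝ) = u 0 := by exact_mod_cast hw0
    rw [e, sub_self, mul_zero, add_zero] at h0
    exact (dartSeg_coord_ne hv hz 0 (u 0)).1 ⟨by linarith, by linarith⟩
  · have e : (w 0 : ℝ) = u 0 := by exact_mod_cast hw0
    rw [e, sub_self, mul_zero, add_zero] at h0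
    exact (dartSeg_coord_ne hv hz 0 (u 0)).1 ⟨by linarith, by linarith⟩

/-- **Dart pieces miss every centre segment** of adjacent faces: such a segment has a
half-integer coordinate across. [folklore] -/
theorem dartSeg_inter_centerSeg {v f f' g' : Site 2} (hv : IsCorner v f) (hfg : (zdGraph 2).Adj f' g')
    {z : ℂ} (hz : z ∈ dartSeg v f) (hz' : z ∈ centerSeg f' g') : False := by
  obtain ⟨s, hs0, hs1, h⟩ := centerSeg_coord hz'
  have h0 := h 0
  have h1 := h 1
  rcases (Percolation.zdGraph_two_adj_iff f' g').1 hfg with ⟨hw0, hw1⟩ | ⟨hw0, hw1⟩ | ⟨hw1, hw0⟩ | ⟨hw1, hw0⟩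
  · have e : (g' 1 : ℝ) = f' 1 := by exact_mod_cast hw1
    rw [e, sub_self, mul_zero, add_zero] at h1
    exact (dartSeg_coord_ne hv hz 1 (f' 1)).2 ⟨by linarith, by linarith⟩
  · have e : (g' 1 : ℝ) = f' 1 := by exact_mod_cast hw1
    rw [e, sub_self, mul_zero, add_zero] at h1
    exact (dartSeg_coord_ne hv hz 1 (f' 1)).2 ⟨by linarith, by linarith⟩
  · have e : (g' 0 : ℝ) = f' 0 := by exact_mod_cast hw0
    rw [e, sub_self, mul_zero, add_zero] at h0
    exact (dartSeg_coord_ne hv hz 0 (f' 0)).2 ⟨by linarith, by linarith⟩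
  · have e : (g' 0 : ℝ) = f' 0 := by exact_mod_cast hw0
    rw [e, sub_self, mul_zero, add_zero] at h0
    exact (dartSeg_coord_ne hv hz 0 (f' 0)).2 ⟨by linarith, by linarith⟩

/-- **A dart piece meets a closed face only if it is its own face.** [folklore] -/
theorem eq_of_dartSeg_inter_closedSq {v f g : Site 2} (hv : IsCorner v f) {z : ℂ} (hz : z ∈ dartSeg v f)
    (hz' : z ∈ closedSq g) : g = f := by
  funext k
  obtain ⟨h1, h2⟩ := dartSeg_subset_openSq hv hz k
  obtain ⟨h3, h4⟩ := hz' k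
  rcases int_trichotomy (g k) (f k) with h | ⟨h, -⟩ | h
  · exfalso; linarith
  · exact h
  · exfalso; linarith

/-- **The vertex-connector shape**: coordinate `i` constant at `a + 3/8` or `a + 5/8`,
coordinate `j ≠ i` within `1/8` of the integer `g` (the connector across the edge on the line
`{x_j = g}`, column `a`). [folklore] -/
def VConnShape (i j : Fin 2) (a g : ℤ) (z : ℂ) : Prop :=
  j ≠ i ∧ (Percolation.coordVec z i = a + 3 / 8 ∨ Percolation.coordVec z i = a + 5 / 8) ∧
    (g : ℝ) - 1 / 8 ≤ Percolation.coordVec z j ∧ Percolation.coordVec z j ≤ g + 1 / 8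

/-- **The face-connector shape**: coordinate `i` in `[a + 3/8, a + 5/8]`, coordinate `j ≠ i`
constant at `b + 1/8` or `b + 7/8` (the connector along a side of the face `(a, b)` in
`(i, j)`-coordinates, `1/8` inside). [folklore] -/
def FConnShape (i j : Fin 2) (a b : ℤ) (z : ℂ) : Prop :=
  j ≠ i ∧ ((a : ℝ) + 3 / 8 ≤ Percolation.coordVec z i ∧ Percolation.coordVec z i ≤ a + 5 / 8) ∧
    (Percolation.coordVec z j = b + 1 / 8 ∨ Percolation.coordVec z j = b + 7 / 8)

/-- Vertex connectors miss half-diagonals (shape form of `vConnShape_inter_halfDiag`).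
[folklore] -/
theorem VConnShape.not_mem_halfDiag {i j : Fin 2} {a g : ℤ} {z : ℂ} (h : VConnShape i j a g z)
    {v f : Site 2} (hv : IsCorner v f) : z ∉ halfDiag v f := fun hz =>
  vConnShape_inter_halfDiag (a := a) (g := g) (c := Percolation.coordVec z i) h.2.1 hv rfl h.2.2 hz

/-- Face connectors miss half-diagonals (shape form of `fConnShape_inter_halfDiag`).
[folklore] -/
theorem FConnShape.not_mem_halfDiag {i j : Fin 2} {a b : ℤ} {z : ℂ} (h : FConnShape i j a b z)
    {v f : Site 2} (hv : IsCorner v f) : z ∉ halfDiag v f := fun hz =>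
  fConnShape_inter_halfDiag (a := a) (b := b) (c' := Percolation.coordVec z j) h.2.2 hv h.2.1 rfl hz

/-- An integer plus a parameter in `[0, 1]` equal to `a + 3/8` or `a + 5/8` pins the integer
to `a`. [folklore] -/
private theorem int_eq_of_add_frac {m a : ℤ} {s : ℝ} (hs0 : 0 ≤ s) (hs1 : s ≤ 1)
    (h : (m : ℝ) + s = a + 3 / 8 ∨ (m : ℝ) + s = a + 5 / 8) : m = a := by
  rcases int_trichotomy m a with hm | ⟨hm, -⟩ | hm
  · exfalso; rcases h with h | h <;> linarith
  · exact hm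
  · exfalso; rcases h with h | h <;> linarith

/-- An integer minus a parameter in `[0, 1]` equal to `a + 3/8` or `a + 5/8` pins the integer
to `a + 1`. [folklore] -/
private theorem int_eq_of_sub_frac {m a : ℤ} {s : ℝ} (hs0 : 0 ≤ s) (hs1 : s ≤ 1)
    (h : (m : ℝ) - s = a + 3 / 8 ∨ (m : ℝ) - s = a + 5 / 8) : m = a + 1 := by
  rcases int_trichotomy m (a + 1) with hm | ⟨hm, -⟩ | hm
  · exfalso; push_cast at hm; rcases h with h | h <;> linarith
  · exact hm
  · exfalso; push_cast at hm; rcases h with h | h <;> linarith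

/-- An integer is not `a + 3/8` or `a + 5/8`. [folklore] -/
private theorem int_ne_frac {m a : ℤ} (h : (m : ℝ) = a + 3 / 8 ∨ (m : ℝ) = a + 5 / 8) : False := by
  rcases int_trichotomy m a with hm | ⟨-, hm⟩ | hm <;> rcases h with h | h <;> linarith

/-- An integer is not `b + 1/8` or `b + 7/8`. [folklore] -/
private theorem int_ne_frac' {m b : ℤ} (h : (m : ℝ) = b + 1 / 8 ∨ (m : ℝ) = b + 7 / 8) : False := by
  rcases int_trichotomy m b with hm | ⟨-, hm⟩ | hm <;> rcases h with h | h <;> linarith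

/-- An integer is not in `[a + 3/8, a + 5/8]`. [folklore] -/
private theorem int_not_mem_midWindow {m a : ℤ} (h1 : (a : ℝ) + 3 / 8 ≤ m) (h2 : (m : ℝ) ≤ a + 5 / 8) : False := by
  rcases int_trichotomy m a with hm | ⟨-, hm⟩ | hm <;> linarith

/-- An integer within `1/8` of the integer `g` is `g`. [folklore] -/
private theorem int_eq_of_near {m g : ℤ} (h1 : (g : ℝ) - 1 / 8 ≤ m) (h2 : (m : ℝ) ≤ g + 1 / 8) : m = g := by
  rcases int_trichotomy m g with hm | ⟨hm, -⟩ | hm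
  · exfalso; linarith
  · exact hm
  · exfalso; linarith

/-- The real form of an integer identity, for rewriting coordinates. [folklore] -/
private theorem cast_eq_of_eq {m n : ℤ} (h : m = n) : (m : ℝ) = n := by rw [h]

/-- **A vertex connector meets a lattice edge only if it is the crossed edge**: the edge then
lies on the line `{x_j = g}` and occupies column `a`. [folklore] -/
theorem VConnShape.edge_eq {i j : Fin 2} {a g : ℤ} {z : ℂ} (h : VConnShape i j a g z) {u w : Site 2}
    (huw : (zdGraph 2).Adj u w) (hz : z ∈ Percolation.edgeTrace s(u, w)) :
    u j = g ∧ w j = g ∧ ((u i = a ∧ w i = a + 1) ∨ (u i = a + 1 ∧ w i = a)) := by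
  obtain ⟨hji, hzi, hzj1, hzj2⟩ := h
  rw [Percolation.edgeTrace_mk, mem_segment_iff_coordVec] at hz
  obtain ⟨s, hs0, hs1, hc⟩ := hz
  simp only [Percolation.coordVec_toComplex] at hc
  have hc0 := hc 0
  have hc1 := hc 1
  rcases fin_two_eq_other hji with ⟨rfl, rfl⟩ | ⟨rfl, rfl⟩ <;>
    rcases (Percolation.zdGraph_two_adj_iff u w).1 huw with ⟨hw0, hw1⟩ | ⟨hw0, hw1⟩ | ⟨hw1, hw0⟩ | ⟨hw1, hw0⟩
  -- `i = 0`, `j = 1`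
  · rw [cast_eq_of_eq hw1, sub_self, mul_zero, add_zero] at hc1
    rw [cast_eq_of_eq hw0] at hc0
    have hg : u 1 = g := int_eq_of_near (by linarith) (by linarith)
    have ha : u 0 = a := int_eq_of_add_frac hs0 hs1 (by
      rcases hzi with h | h <;> [left; right] <;> push_cast at hc0 ⊢ <;> linarith)
    exact ⟨hg, by omega, Or.inl ⟨ha, by omega⟩⟩
  · rw [cast_eq_of_eq hw1, sub_self, mul_zero, add_zero] at hc1
    have hu := cast_eq_of_eq hw0
    push_cast at hu
    have hg : u 1 = g := int_eq_of_near (by linarith) (by linarith)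
    have ha : u 0 = a + 1 := int_eq_of_sub_frac (s := s) hs0 hs1 (by
      rcases hzi with h | h <;> [left; right] <;> nlinarith)
    exact ⟨hg, by omega, Or.inr ⟨ha, by omega⟩⟩
  · rw [cast_eq_of_eq hw0, sub_self, mul_zero, add_zero] at hc0
    exact (int_ne_frac (m := u 0) (a := a) (by rcases hzi with h | h <;> [left; right] <;> linarith)).elim
  · rw [cast_eq_of_eq hw0, sub_self, mul_zero, add_zero] at hc0
    exact (int_ne_frac (m := u 0) (a := a) (by rcases hzi with h | h <;> [left; right] <;> linarith)).elim
  -- `i = 1`, `j = 0`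
  · rw [cast_eq_of_eq hw1, sub_self, mul_zero, add_zero] at hc1
    exact (int_ne_frac (m := u 1) (a := a) (by rcases hzi with h | h <;> [left; right] <;> linarith)).elim
  · rw [cast_eq_of_eq hw1, sub_self, mul_zero, add_zero] at hc1
    exact (int_ne_frac (m := u 1) (a := a) (by rcases hzi with h | h <;> [left; right] <;> linarith)).elim
  · rw [cast_eq_of_eq hw0, sub_self, mul_zero, add_zero] at hc0
    rw [cast_eq_of_eq hw1] at hc1
    have hg : u 0 = g := int_eq_of_near (by linarith) (by linarith)
    have ha : u 1 = a := int_eq_of_add_frac hs0 hs1 (by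
      rcases hzi with h | h <;> [left; right] <;> push_cast at hc1 ⊢ <;> linarith)
    exact ⟨hg, by omega, Or.inl ⟨ha, by omega⟩⟩
  · rw [cast_eq_of_eq hw0, sub_self, mul_zero, add_zero] at hc0
    have hu := cast_eq_of_eq hw1
    push_cast at hu
    have hg : u 0 = g := int_eq_of_near (by linarith) (by linarith)
    have ha : u 1 = a + 1 := int_eq_of_sub_frac (s := s) hs0 hs1 (by
      rcases hzi with h | h <;> [left; right] <;> nlinarith)
    exact ⟨hg, by omega, Or.inr ⟨ha, by omega⟩⟩

/-- **Face connectors miss every lattice edge**: a lattice edge has an integer coordinate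
across, while a face connector has one coordinate in `[3/8, 5/8] + ℤ` and the other in
`{1/8, 7/8} + ℤ`. [folklore] -/
theorem FConnShape.not_mem_edgeTrace {i j : Fin 2} {a b : ℤ} {z : ℂ} (h : FConnShape i j a b z)
    {u w : Site 2} (huw : (zdGraph 2).Adj u w) : z ∉ Percolation.edgeTrace s(u, w) := by
  intro hz
  obtain ⟨hji, ⟨hzi1, hzi2⟩, hzj⟩ := h
  rw [Percolation.edgeTrace_mk, mem_segment_iff_coordVec] at hz
  obtain ⟨s, hs0, hs1, hc⟩ := hz
  simp only [Percolation.coordVec_toComplex] at hc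
  have hc0 := hc 0
  have hc1 := hc 1
  rcases fin_two_eq_other hji with ⟨rfl, rfl⟩ | ⟨rfl, rfl⟩ <;>
    rcases (Percolation.zdGraph_two_adj_iff u w).1 huw with ⟨hw0, hw1⟩ | ⟨hw0, hw1⟩ | ⟨hw1, hw0⟩ | ⟨hw1, hw0⟩
  · rw [cast_eq_of_eq hw1, sub_self, mul_zero, add_zero] at hc1
    exact int_ne_frac' (m := u 1) (b := b) (by rcases hzj with h | h <;> [left; right] <;> linarith)
  · rw [cast_eq_of_eq hw1, sub_self, mul_zero, add_zero] at hc1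
    exact int_ne_frac' (m := u 1) (b := b) (by rcases hzj with h | h <;> [left; right] <;> linarith)
  · rw [cast_eq_of_eq hw0, sub_self, mul_zero, add_zero] at hc0
    exact int_not_mem_midWindow (m := u 0) (a := a) (by linarith) (by linarith)
  · rw [cast_eq_of_eq hw0, sub_self, mul_zero, add_zero] at hc0
    exact int_not_mem_midWindow (m := u 0) (a := a) (by linarith) (by linarith)
  · rw [cast_eq_of_eq hw1, sub_self, mul_zero, add_zero] at hc1
    exact int_not_mem_midWindow (m := u 1) (a := a) (by linarith) (by linarith)
  · rw [cast_eq_of_eq hw1, sub_self, mul_zero, add_zero] at hc1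
    exact int_not_mem_midWindow (m := u 1) (a := a) (by linarith) (by linarith)
  · rw [cast_eq_of_eq hw0, sub_self, mul_zero, add_zero] at hc0
    exact int_ne_frac' (m := u 0) (b := b) (by rcases hzj with h | h <;> [left; right] <;> linarith)
  · rw [cast_eq_of_eq hw0, sub_self, mul_zero, add_zero] at hc0
    exact int_ne_frac' (m := u 0) (b := b) (by rcases hzj with h | h <;> [left; right] <;> linarith)

/-- **Vertex connectors miss every centre segment** of adjacent faces: such a segment has a
coordinate constantly in `1/2 + ℤ`, incompatible with both connector coordinates. [folklore] -/
theorem VConnShape.not_mem_centerSeg {i j : Fin 2} {a g : ℤ} {z : ℂ} (h : VConnShape i j a g z)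
    {f' g' : Site 2} (hfg : (zdGraph 2).Adj f' g') : z ∉ centerSeg f' g' := by
  intro hz
  obtain ⟨hji, hzi, hzj1, hzj2⟩ := h
  obtain ⟨s, hs0, hs1, hc⟩ := centerSeg_coord hz
  have hc0 := hc 0
  have hc1 := hc 1
  rcases fin_two_eq_other hji with ⟨rfl, rfl⟩ | ⟨rfl, rfl⟩ <;>
    rcases (Percolation.zdGraph_two_adj_iff f' g').1 hfg with ⟨hw0, hw1⟩ | ⟨hw0, hw1⟩ | ⟨hw1, hw0⟩ | ⟨hw1, hw0⟩
  · rw [cast_eq_of_eq hw1, sub_self, mul_zero, add_zero] at hc1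
    rcases int_trichotomy (f' 1) g with hm | ⟨-, hm⟩ | hm <;> linarith
  · rw [cast_eq_of_eq hw1, sub_self, mul_zero, add_zero] at hc1
    rcases int_trichotomy (f' 1) g with hm | ⟨-, hm⟩ | hm <;> linarith
  · rw [cast_eq_of_eq hw0, sub_self, mul_zero, add_zero] at hc0
    rcases int_trichotomy (f' 0) a with hm | ⟨-, hm⟩ | hm <;> rcases hzi with h | h <;> linarith
  · rw [cast_eq_of_eq hw0, sub_self, mul_zero, add_zero] at hc0
    rcases int_trichotomy (f' 0) a with hm | ⟨-, hm⟩ | hm <;> rcases hzi with h | h <;> linarith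
  · rw [cast_eq_of_eq hw1, sub_self, mul_zero, add_zero] at hc1
    rcases int_trichotomy (f' 1) a with hm | ⟨-, hm⟩ | hm <;> rcases hzi with h | h <;> linarith
  · rw [cast_eq_of_eq hw1, sub_self, mul_zero, add_zero] at hc1
    rcases int_trichotomy (f' 1) a with hm | ⟨-, hm⟩ | hm <;> rcases hzi with h | h <;> linarith
  · rw [cast_eq_of_eq hw0, sub_self, mul_zero, add_zero] at hc0
    rcases int_trichotomy (f' 0) g with hm | ⟨-, hm⟩ | hm <;> linarith
  · rw [cast_eq_of_eq hw0, sub_self, mul_zero, add_zero] at hc0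
    rcases int_trichotomy (f' 0) g with hm | ⟨-, hm⟩ | hm <;> linarith

/-- **A face connector meets a centre segment only along the common side.** If the face
connector (column `a`, `1/8` inside its face from the lattice line `{x_j = L}`: `L = b` when
it runs at height `b + 1/8`, `L = b + 1` when at height `b + 7/8`) meets the centre segment of
the adjacent faces `f'`, `g'`, then `f'`, `g'` are the two faces of column `a` on either side of
the line `{x_j = L}`. [folklore] -/
theorem FConnShape.centerSeg_faces {i j : Fin 2} {a b : ℤ} {z : ℂ} (h : FConnShape i j a b z)
    {L : ℤ} (hL1 : Percolation.coordVec z j = b + 1 / 8 → L = b) (hL2 : Percolation.coordVec z j = b + 7 / 8 → L = b + 1)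
    {f' g' : Site 2} (hfg : (zdGraph 2).Adj f' g') (hz : z ∈ centerSeg f' g') :
    f' i = a ∧ g' i = a ∧ ((g' j = f' j + 1 ∧ L = g' j) ∨ (f' j = g' j + 1 ∧ L = f' j)) := by
  obtain ⟨hji, ⟨hzi1, hzi2⟩, hzj⟩ := h
  obtain ⟨s, hs0, hs1, hc⟩ := centerSeg_coord hz
  have hc0 := hc 0
  have hc1 := hc 1
  rcases fin_two_eq_other hji with ⟨rfl, rfl⟩ | ⟨rfl, rfl⟩ <;>
    rcases (Percolation.zdGraph_two_adj_iff f' g').1 hfg with ⟨hw0, hw1⟩ | ⟨hw0, hw1⟩ | ⟨hw1, hw0⟩ | ⟨hw1, hw0⟩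
  -- `i = 0`, `j = 1`: horizontal neighbours are impossible
  · rw [cast_eq_of_eq hw1, sub_self, mul_zero, add_zero] at hc1
    exfalso
    rcases int_trichotomy (f' 1) b with hm | ⟨-, hm⟩ | hm <;> rcases hzj with h | h <;> linarith
  · rw [cast_eq_of_eq hw1, sub_self, mul_zero, add_zero] at hc1
    exfalso
    rcases int_trichotomy (f' 1) b with hm | ⟨-, hm⟩ | hm <;> rcases hzj with h | h <;> linarith
  · -- `g' = f' + e₁`
    rw [cast_eq_of_eq hw0, sub_self, mul_zero, add_zero] at hc0
    rw [cast_eq_of_eq hw1] at hc1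
    push_cast at hc1
    have ha : f' 0 = a := by
      rcases int_trichotomy (f' 0) a with hm | ⟨hm, -⟩ | hm
      · exfalso; linarith
      · exact hm
      · exfalso; linarith
    refine ⟨ha, by omega, Or.inl ⟨hw1, ?_⟩⟩
    rcases hzj with h | h
    · rw [hL1 h]
      rcases int_trichotomy (f' 1 + 1) b with hm | ⟨hm, -⟩ | hm
      · exfalso; push_cast at hm; linarith
      · omega
      · exfalso; push_cast at hm; linarith
    · rw [hL2 h]
      rcases int_trichotomy (f' 1) b with hm | ⟨hm, -⟩ | hm
      · exfalso; linarith
      · omega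
      · exfalso; linarith
  · -- `f' = g' + e₁`
    rw [cast_eq_of_eq hw0, sub_self, mul_zero, add_zero] at hc0
    rw [cast_eq_of_eq hw1] at hc1
    push_cast at hc1
    have ha : f' 0 = a := by
      rcases int_trichotomy (f' 0) a with hm | ⟨hm, -⟩ | hm
      · exfalso; linarith
      · exact hm
      · exfalso; linarith
    refine ⟨ha, by omega, Or.inr ⟨hw1, ?_⟩⟩
    rcases hzj with h | h
    · rw [hL1 h]
      rcases int_trichotomy (g' 1 + 1) b with hm | ⟨hm, -⟩ | hm
      · exfalso; push_cast at hm; linarith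
      · omega
      · exfalso; push_cast at hm; linarith
    · rw [hL2 h]
      rcases int_trichotomy (g' 1) b with hm | ⟨hm, -⟩ | hm
      · exfalso; linarith
      · omega
      · exfalso; linarith
  -- `i = 1`, `j = 0`
  · -- `g' = f' + e₀`
    rw [cast_eq_of_eq hw1, sub_self, mul_zero, add_zero] at hc1
    rw [cast_eq_of_eq hw0] at hc0
    push_cast at hc0
    have ha : f' 1 = a := by
      rcases int_trichotomy (f' 1) a with hm | ⟨hm, -⟩ | hm
      · exfalso; linarith
      · exact hm
      · exfalso; linarith
    refine ⟨ha, by omega, Or.inl ⟨hw0, ?_⟩⟩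
    rcases hzj with h | h
    · rw [hL1 h]
      rcases int_trichotomy (f' 0 + 1) b with hm | ⟨hm, -⟩ | hm
      · exfalso; push_cast at hm; linarith
      · omega
      · exfalso; push_cast at hm; linarith
    · rw [hL2 h]
      rcases int_trichotomy (f' 0) b with hm | ⟨hm, -⟩ | hm
      · exfalso; linarith
      · omega
      · exfalso; linarith
  · -- `f' = g' + e₀`
    rw [cast_eq_of_eq hw1, sub_self, mul_zero, add_zero] at hc1
    rw [cast_eq_of_eq hw0] at hc0
    push_cast at hc0
    have ha : f' 1 = a := by
      rcases int_trichotomy (f' 1) a with hm | ⟨hm, -⟩ | hm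
      · exfalso; linarith
      · exact hm
      · exfalso; linarith
    refine ⟨ha, by omega, Or.inr ⟨hw0, ?_⟩⟩
    rcases hzj with h | h
    · rw [hL1 h]
      rcases int_trichotomy (g' 0 + 1) b with hm | ⟨hm, -⟩ | hm
      · exfalso; push_cast at hm; linarith
      · omega
      · exfalso; push_cast at hm; linarith
    · rw [hL2 h]
      rcases int_trichotomy (g' 0) b with hm | ⟨hm, -⟩ | hm
      · exfalso; linarith
      · omega
      · exfalso; linarith
  · rw [cast_eq_of_eq hw0, sub_self, mul_zero, add_zero] at hc0
    exfalso
    rcases int_trichotomy (f' 0) b with hm | ⟨-, hm⟩ | hm <;> rcases hzj with h | h <;> linarith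
  · rw [cast_eq_of_eq hw0, sub_self, mul_zero, add_zero] at hc0
    exfalso
    rcases int_trichotomy (f' 0) b with hm | ⟨-, hm⟩ | hm <;> rcases hzj with h | h <;> linarith

/-- **A vertex connector meets a closed face only if it is one of the two faces of the
crossed edge** (column `a`, on either side of the line `{x_j = g}`). [folklore] -/
theorem VConnShape.closedSq_faces {i j : Fin 2} {a g : ℤ} {z : ℂ} (h : VConnShape i j a g z)
    {g' : Site 2} (hz : z ∈ closedSq g') : g' i = a ∧ (g' j = g ∨ g' j + 1 = g) := by
  obtain ⟨hji, hzi, hzj1, hzj2⟩ := h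
  obtain ⟨hi1, hi2⟩ := hz i
  obtain ⟨hj1, hj2⟩ := hz j
  constructor
  · rcases int_trichotomy (g' i) a with hm | ⟨hm, -⟩ | hm
    · exfalso; rcases hzi with h | h <;> linarith
    · exact hm
    · exfalso; rcases hzi with h | h <;> linarith
  · rcases int_trichotomy (g' j) g with hm | ⟨hm, -⟩ | hm
    · right
      rcases int_trichotomy (g' j + 1) g with hm' | ⟨hm', -⟩ | hm'
      · exfalso; push_cast at hm'; linarith
      · exact hm'
      · exfalso; push_cast at hm'; linarith
    · exact Or.inl hm
    · exfalso; linarith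

/-- **A face connector meets a closed face only if it is its own face.** [folklore] -/
theorem FConnShape.closedSq_face {i j : Fin 2} {a b : ℤ} {z : ℂ} (h : FConnShape i j a b z)
    {g' : Site 2} (hz : z ∈ closedSq g') : g' i = a ∧ g' j = b := by
  obtain ⟨hji, ⟨hzi1, hzi2⟩, hzj⟩ := h
  obtain ⟨hi1, hi2⟩ := hz i
  obtain ⟨hj1, hj2⟩ := hz j
  constructor
  · rcases int_trichotomy (g' i) a with hm | ⟨hm, -⟩ | hm
    · exfalso; linarith
    · exact hm
    · exfalso; linarith
  · rcases int_trichotomy (g' j) b with hm | ⟨hm, -⟩ | hm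
    · exfalso; rcases hzj with h | h <;> linarith
    · exact hm
    · exfalso; rcases hzj with h | h <;> linarith

/-! ### Connector shapes from the corner data of a turn -/

/-- **Shape of a vertex connector.** For two faces `f₁ ≠ f₂` with the common corner `v`, in
the same column in direction `i` (`f₁ i = f₂ i`) and on either side of the lattice line through
`v` across `i`, every point of the connector `[dartPt v f₁ i, dartPt v f₂ i]` has the
vertex-connector shape (column `f₁ i`, line `v j`). [folklore] -/
theorem vConn_shape {v f₁ f₂ : Site 2} {i j : Fin 2} (hji : j ≠ i) (hfi : f₁ i = f₂ i)
    (hfj : (f₁ j + 1 = v j ∧ f₂ j = v j) ∨ (f₁ j = v j ∧ f₂ j + 1 = v j)) {z : ℂ}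
    (hz : z ∈ segment ℝ (dartPt v f₁ i) (dartPt v f₂ i)) : VConnShape i j (f₁ i) (v j) z := by
  rw [mem_segment_iff_coordVec] at hz
  obtain ⟨t, ht0, ht1, hc⟩ := hz
  have hci := hc i
  have hcj := hc j
  rw [coordVec_dartPt_self, coordVec_dartPt_self] at hci
  rw [coordVec_dartPt_of_ne _ _ hji, coordVec_dartPt_of_ne _ _ hji] at hcj
  refine ⟨hji, ?_, ?_⟩
  · -- along `i`: both endpoints agree
    have ht : toward v f₂ i = toward v f₁ i := by
      unfold toward; rw [hfi]
    rw [ht, cast_eq_of_eq hfi.symm, sub_self, mul_zero, add_zero] at hci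
    unfold toward at hci
    split_ifs at hci with h
    · exact Or.inl hci
    · exact Or.inr hci
  · -- across `i`: from `v j - 1/8` to `v j + 1/8`
    unfold inward at hcj
    rcases hfj with ⟨h1, h2⟩ | ⟨h1, h2⟩
    · rw [if_neg (show ¬ v j = f₁ j by omega), if_pos h2.symm, cast_eq_of_eq h2] at hcj
      have e1 : (f₁ j : ℝ) = v j - 1 := by
        have := cast_eq_of_eq h1; push_cast at this; linarith
      rw [e1] at hcj
      constructor <;> nlinarith
    · rw [if_pos h1.symm, if_neg (show ¬ v j = f₂ j by omega), cast_eq_of_eq h1] at hcj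
      have e2 : (f₂ j : ℝ) = v j - 1 := by
        have := cast_eq_of_eq h2; push_cast at this; linarith
      rw [e2] at hcj
      constructor <;> nlinarith

/-- **Shape of a face connector.** For two distinct corners `v₁`, `v₂` of the face `f` spanning
its side in direction `i` (`v₁ i + v₂ i = 2 f i + 1`, `v₁ j = v₂ j`), every point of the
connector `[dartPt v₁ f i, dartPt v₂ f i]` has the face-connector shape (face `f`), at height
`f j + 1/8` iff the side is the lower one (`v₁ j = f j`). [folklore] -/
theorem fConn_shape {v₁ v₂ f : Site 2} (hv₁ : IsCorner v₁ f) {i j : Fin 2}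
    (hji : j ≠ i) (hvi : v₁ i + v₂ i = 2 * f i + 1) (hvj : v₁ j = v₂ j) {z : ℂ}
    (hz : z ∈ segment ℝ (dartPt v₁ f i) (dartPt v₂ f i)) :
    FConnShape i j (f i) (f j) z ∧ (Percolation.coordVec z j = f j + 1 / 8 → v₁ j = f j) ∧
      (Percolation.coordVec z j = f j + 7 / 8 → v₁ j = f j + 1) := by
  rw [mem_segment_iff_coordVec] at hz
  obtain ⟨t, ht0, ht1, hc⟩ := hz
  have hci := hc i
  have hcj := hc j
  rw [coordVec_dartPt_self, coordVec_dartPt_self] at hci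
  rw [coordVec_dartPt_of_ne _ _ hji, coordVec_dartPt_of_ne _ _ hji] at hcj
  have hin : inward v₂ f j = inward v₁ f j := by unfold inward; rw [hvj]
  rw [hin, sub_self, mul_zero, add_zero] at hcj
  refine ⟨⟨hji, ?_, ?_⟩, ?_, ?_⟩
  · unfold toward at hci
    rcases hv₁ i with h1 | h1
    · rw [if_pos h1, if_neg (show ¬ v₂ i = f i by omega)] at hci
      constructor <;> nlinarith
    · rw [if_neg (show ¬ v₁ i = f i by omega), if_pos (show v₂ i = f i by omega)] at hci
      constructor <;> nlinarith
  · unfold inward at hcj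
    split_ifs at hcj with h
    · exact Or.inl hcj
    · exact Or.inr hcj
  · intro h
    unfold inward at hcj
    split_ifs at hcj with h'
    · exact h'
    · exfalso; linarith
  · intro h
    unfold inward at hcj
    split_ifs at hcj with h'
    · exfalso; linarith
    · rcases hv₁ j with h'' | h''
      · exact absurd h'' h'
      · exact h''

/-! ### Source and target directions of a corner -/

/-- The direction (`0` horizontal, `1` vertical) of the source edge of the dart `(v, f)`
(cf. `cornerSource`). [folklore] -/
def srcDir (v f : Site 2) : Fin 2 := if v 0 - f 0 = v 1 - f 1 then 0 else 1

/-- The direction of the target edge of the dart `(v, f)` (cf. `cornerTarget`). [folklore] -/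
def tgtDir (v f : Site 2) : Fin 2 := if v 0 - f 0 = v 1 - f 1 then 1 else 0

/-- `cornerSource` is the corner edge in the source direction. [folklore] -/
theorem cornerSource_eq_cornerEdge (v f : Site 2) : cornerSource v f = cornerEdge v f (srcDir v f) := by
  unfold cornerSource srcDir; split_ifs <;> rfl

/-- `cornerTarget` is the corner edge in the target direction. [folklore] -/
theorem cornerTarget_eq_cornerEdge (v f : Site 2) : cornerTarget v f = cornerEdge v f (tgtDir v f) := by
  unfold cornerTarget tgtDir; split_ifs <;> rfl

/-- Source and target directions differ. [folklore] -/
theorem tgtDir_ne_srcDir (v f : Site 2) : tgtDir v f ≠ srcDir v f := by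
  unfold tgtDir srcDir; split_ifs <;> decide

/-- The dart piece is the segment from the shifted source point to the shifted target point
(as a set; `dartSeg` lists the endpoints by direction). [folklore] -/
theorem dartSeg_eq_segment_src_tgt (v f : Site 2) :
    dartSeg v f = segment ℝ (dartPt v f (srcDir v f)) (dartPt v f (tgtDir v f)) := by
  unfold dartSeg srcDir tgtDir
  split_ifs
  · rfl
  · exact segment_symm ℝ _ _

/-- **Vertex turn, directions and columns.** If the dart `(v, f₁)` is followed by the dart
`(v, f₂)` around the common vertex (`cornerTarget v f₁ = cornerSource v f₂`, `f₁ ≠ f₂`), then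
the target direction of the first is the source direction `i` of the second, the two faces are
in the same column in direction `i` and on either side of the lattice line through `v` across
`i`. [folklore] -/
theorem vertexTurn_dirs {v f₁ f₂ : Site 2} (hv₁ : IsCorner v f₁) (hv₂ : IsCorner v f₂) (hne : f₁ ≠ f₂)
    (he : cornerTarget v f₁ = cornerSource v f₂) :
    srcDir v f₂ = tgtDir v f₁ ∧ f₁ (tgtDir v f₁) = f₂ (tgtDir v f₁) ∧
      ∀ j, j ≠ tgtDir v f₁ →
        (f₁ j + 1 = v j ∧ f₂ j = v j) ∨ (f₁ j = v j ∧ f₂ j + 1 = v j) := by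
  rw [cornerTarget_eq_cornerEdge, cornerSource_eq_cornerEdge] at he
  obtain ⟨hdir, hcol⟩ := cornerEdge_eq_cornerEdge_aux hv₁ hv₂ rfl he
  refine ⟨hdir.symm, hcol, fun j hj => ?_⟩
  have hfj : f₁ j ≠ f₂ j := by
    intro h
    apply hne
    funext k
    rcases fin_two_cases_of_ne hj k with rfl | rfl
    · exact hcol
    · exact h
  rcases hv₁ j with h1 | h1 <;> rcases hv₂ j with h2 | h2 <;> omega

/-- **Face turn, directions and corners.** If the dart `(v₁, f)` is followed by the dart
`(v₂, f)` inside the common face (`cornerTarget v₁ f = cornerSource v₂ f`, `v₁ ≠ v₂`), then the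
target direction of the first is the source direction `i` of the second and `v₂` is the other
end of the side of `f` at `v₁` in direction `i`. [folklore] -/
theorem faceTurn_dirs {v₁ v₂ f : Site 2} (hne : v₁ ≠ v₂) (he : cornerTarget v₁ f = cornerSource v₂ f) :
    srcDir v₂ f = tgtDir v₁ f ∧ v₁ (tgtDir v₁ f) + v₂ (tgtDir v₁ f) = 2 * f (tgtDir v₁ f) + 1 ∧
      ∀ j, j ≠ tgtDir v₁ f → v₁ j = v₂ j := by
  rw [cornerTarget_eq_cornerEdge, cornerSource_eq_cornerEdge, cornerEdge, cornerEdge, Sym2.eq_iff] at he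
  set i₁ := tgtDir v₁ f with hi₁
  set i₂ := srcDir v₂ f with hi₂
  rcases he with ⟨h, -⟩ | ⟨h1, h2⟩
  · exact absurd h hne
  · -- `v₁ = cornerNeighbor v₂ f i₂`, `cornerNeighbor v₁ f i₁ = v₂`
    have hA : ∀ k, k ≠ i₁ → v₂ k = v₁ k := fun k hk => by
      rw [← h2, cornerNeighbor_apply_of_ne hk]
    have hA' : v₂ i₁ = 2 * f i₁ + 1 - v₁ i₁ := by
      rw [← h2]; simp [cornerNeighbor]
    have hB : ∀ k, k ≠ i₂ → v₁ k = v₂ k := fun k hk => by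
      rw [h1, cornerNeighbor_apply_of_ne hk]
    have hB' : v₁ i₂ = 2 * f i₂ + 1 - v₂ i₂ := by
      conv_lhs => rw [h1]
      simp [cornerNeighbor]
    have hdir : i₂ = i₁ := by
      by_contra hne'
      have e1 := hA i₂ hne'
      omega
    refine ⟨hdir, by omega, fun j hj => (hA j hj).symm⟩

/-! ### Distance bookkeeping -/

/-- The shifted side points of a dart are within distance `2` of its vertex. [folklore] -/
theorem dist_dartPt_toComplex_le {v f : Site 2} (hv : IsCorner v f) (i : Fin 2) :
    dist (dartPt v f i) (Site.toComplex v) ≤ 2 := by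
  rw [Complex.dist_eq]
  refine (Complex.norm_le_abs_re_add_abs_im _).trans ?_
  have h0 : |(dartPt v f i - Site.toComplex v).re| ≤ 1 := by
    have := coordVec_sub (dartPt v f i) (Site.toComplex v) 0
    rw [Percolation.coordVec_zero] at this
    rw [this, Percolation.coordVec_toComplex]
    rcases fin_two_eq_zero_or_one i with rfl | rfl
    · rw [coordVec_dartPt_self]
      unfold toward
      rcases hv.coord_cases 0 with ⟨h, h'⟩ | ⟨h, h'⟩
      · rw [if_pos h, h', abs_le]; constructor <;> linarith
      · rw [if_neg (show ¬ v 0 = f 0 by omega), h', abs_le]; constructor <;> linarith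
    · rw [coordVec_dartPt_of_ne _ _ (show (0 : Fin 2) ≠ 1 by decide)]
      unfold inward
      rcases hv.coord_cases 0 with ⟨h, h'⟩ | ⟨h, h'⟩
      · rw [if_pos h, h', abs_le]; constructor <;> linarith
      · rw [if_neg (show ¬ v 0 = f 0 by omega), h', abs_le]; constructor <;> linarith
  have h1 : |(dartPt v f i - Site.toComplex v).im| ≤ 1 := by
    have := coordVec_sub (dartPt v f i) (Site.toComplex v) 1
    rw [Percolation.coordVec_one] at this
    rw [this, Percolation.coordVec_toComplex]
    rcases fin_two_eq_zero_or_one i with rfl | rfl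
    · rw [coordVec_dartPt_of_ne _ _ (show (1 : Fin 2) ≠ 0 by decide)]
      unfold inward
      rcases hv.coord_cases 1 with ⟨h, h'⟩ | ⟨h, h'⟩
      · rw [if_pos h, h', abs_le]; constructor <;> linarith
      · rw [if_neg (show ¬ v 1 = f 1 by omega), h', abs_le]; constructor <;> linarith
    · rw [coordVec_dartPt_self]
      unfold toward
      rcases hv.coord_cases 1 with ⟨h, h'⟩ | ⟨h, h'⟩
      · rw [if_pos h, h', abs_le]; constructor <;> linarith
      · rw [if_neg (show ¬ v 1 = f 1 by omega), h', abs_le]; constructor <;> linarith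
  linarith

/-- The half-diagonal stays within `1` of the vertex. [folklore] -/
theorem halfDiag_subset_closedBall (v f : Site 2) (hv : IsCorner v f) :
    halfDiag v f ⊆ Metric.closedBall (Site.toComplex v) 1 := by
  refine (convex_closedBall _ _).segment_subset (Metric.mem_closedBall.2 (by simp)) (Metric.mem_closedBall.2 ?_)
  rw [Complex.dist_eq]
  refine (Complex.norm_le_abs_re_add_abs_im _).trans ?_
  have h0 : |(faceCenter f - Site.toComplex v).re| ≤ 1 / 2 := by
    simp only [Complex.sub_re, faceCenter_eq, Site.toComplex_re]
    rcases hv.coord_cases 0 with ⟨-, h'⟩ | ⟨-, h'⟩ <;> rw [h', abs_le] <;> constructor <;> linarith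
  have h1 : |(faceCenter f - Site.toComplex v).im| ≤ 1 / 2 := by
    simp only [Complex.sub_im, faceCenter_eq, Site.toComplex_im]
    rcases hv.coord_cases 1 with ⟨-, h'⟩ | ⟨-, h'⟩ <;> rw [h', abs_le] <;> constructor <;> linarith
  linarith

/-- The face centre is within `1` of each corner. [folklore] -/
theorem dist_faceCenter_toComplex_le {v f : Site 2} (hv : IsCorner v f) :
    dist (faceCenter f) (Site.toComplex v) ≤ 1 := by
  rw [Complex.dist_eq]
  refine (Complex.norm_le_abs_re_add_abs_im _).trans ?_
  have h0 : |(faceCenter f - Site.toComplex v).re| ≤ 1 / 2 := by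
    simp only [Complex.sub_re, faceCenter_eq, Site.toComplex_re]
    rcases hv.coord_cases 0 with ⟨-, h'⟩ | ⟨-, h'⟩ <;> rw [h', abs_le] <;> constructor <;> linarith
  have h1 : |(faceCenter f - Site.toComplex v).im| ≤ 1 / 2 := by
    simp only [Complex.sub_im, faceCenter_eq, Site.toComplex_im]
    rcases hv.coord_cases 1 with ⟨-, h'⟩ | ⟨-, h'⟩ <;> rw [h', abs_le] <;> constructor <;> linarith
  linarith

/-- Nearest neighbours of `ℤ²` are at distance `1`, so a lattice edge stays within `1` of its
endpoint. [folklore] -/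
theorem edgeTrace_subset_closedBall {u w : Site 2} (huw : (zdGraph 2).Adj u w) :
    Percolation.edgeTrace s(u, w) ⊆ Metric.closedBall (Site.toComplex u) 1 := by
  rw [Percolation.edgeTrace_mk]
  refine (convex_closedBall _ _).segment_subset (Metric.mem_closedBall.2 (by simp)) (Metric.mem_closedBall.2 ?_)
  rw [Complex.dist_eq]
  refine (Complex.norm_le_abs_re_add_abs_im _).trans ?_
  simp only [Complex.sub_re, Complex.sub_im, Site.toComplex_re, Site.toComplex_im]
  rcases (Percolation.zdGraph_two_adj_iff u w).1 huw with ⟨h0, h1⟩ | ⟨h0, h1⟩ | ⟨h1, h0⟩ | ⟨h1, h0⟩ <;>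
    rw [cast_eq_of_eq h0, cast_eq_of_eq h1] <;> simp

/-- A corner lies in the closed face. [folklore] -/
theorem toComplex_mem_closedSq {v f : Site 2} (hv : IsCorner v f) : Site.toComplex v ∈ closedSq f := by
  intro k
  rw [Percolation.coordVec_toComplex]
  rcases hv.coord_cases k with ⟨-, h⟩ | ⟨-, h⟩ <;> rw [h] <;> constructor <;> linarith

/-- Closed faces are convex. [folklore] -/
theorem convex_closedSq (f : Site 2) : Convex ℝ (closedSq f) := by
  intro z hz w hw a b ha hb hab k
  rw [Percolation.coordVec_add, Percolation.coordVec_smul, Percolation.coordVec_smul]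
  obtain ⟨hz1, hz2⟩ := hz k
  obtain ⟨hw1, hw2⟩ := hw k
  have hab' : a * (f k : ℝ) + b * (f k : ℝ) = f k := by rw [← add_mul, hab, one_mul]
  have h1 := mul_le_mul_of_nonneg_left hz1 ha
  have h2 := mul_le_mul_of_nonneg_left hw1 hb
  have h3 := mul_le_mul_of_nonneg_left hz2 ha
  have h4 := mul_le_mul_of_nonneg_left hw2 hb
  constructor <;> linarith

/-- The closed face has diameter at most `2` (taxicab bound): its points are within `2` of each
corner. [folklore] -/
theorem closedSq_subset_closedBall {v f : Site 2} (hv : IsCorner v f) :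
    closedSq f ⊆ Metric.closedBall (Site.toComplex v) 2 := by
  intro z hz
  rw [Metric.mem_closedBall, Complex.dist_eq]
  refine (Complex.norm_le_abs_re_add_abs_im _).trans ?_
  have h0 : |(z - Site.toComplex v).re| ≤ 1 := by
    have := hz 0
    simp only [Percolation.coordVec_zero] at this
    simp only [Complex.sub_re, Site.toComplex_re]
    rcases hv.coord_cases 0 with ⟨-, h⟩ | ⟨-, h⟩ <;> rw [h, abs_le] <;> constructor <;> linarith
  have h1 : |(z - Site.toComplex v).im| ≤ 1 := by
    have := hz 1
    simp only [Percolation.coordVec_one] at this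
    simp only [Complex.sub_im, Site.toComplex_im]
    rcases hv.coord_cases 1 with ⟨-, h⟩ | ⟨-, h⟩ <;> rw [h, abs_le] <;> constructor <;> linarith
  linarith

/-! ### Scaling -/

/-- The side functional scales quadratically. [folklore] -/
theorem segSide_smul (c : ℝ) (ℓ r z : ℂ) : Literature.Topology.PlaneTopology.segSide (c • ℓ) (c • r) (c • z) = c ^ 2 * Literature.Topology.PlaneTopology.segSide ℓ r z := by
  unfold Literature.Topology.PlaneTopology.segSide
  have : (c • z - c • ℓ) * (starRingEnd ℂ) (c • z - c • r) =
      ((c ^ 2 : ℝ) : ℂ) * ((z - ℓ) * (starRingEnd ℂ) (z - r)) := by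
    simp only [Complex.real_smul, map_sub, map_mul, Complex.conj_ofReal]
    push_cast
    ring
  rw [this, Complex.im_ofReal_mul]

/-- Scaling the picture by `c > 0` preserves the crossing of the dart piece over its
half-diagonal: the crossing defect of `[c • dartPt v f 0, c • dartPt v f 1]` relative to
`[c • v, c • centre f]` is nonzero. [folklore] -/
theorem crossInc_smul_dartSeg_ne_zero {v f : Site 2} (hv : IsCorner v f) {c : ℝ} (hc : 0 < c) :
    (Path.segment (c • dartPt v f 0) (c • dartPt v f 1)).crossInc (c • Site.toComplex v)
      (c • faceCenter f) ≠ 0 := by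
  have hc2 : 0 < c ^ 2 := by positivity
  have hx : ∃ p ∈ segment ℝ (c • dartPt v f 0) (c • dartPt v f 1),
      p ∈ openSegment ℝ (c • Site.toComplex v) (c • faceCenter f) := by
    obtain ⟨p, hp, hp'⟩ := exists_mem_dartSeg_mem_openSegment hv
    refine ⟨c • p, ?_, ?_⟩
    · rw [dartSeg, segment_eq_image'] at hp
      obtain ⟨t, ht, rfl⟩ := hp
      rw [segment_eq_image']
      exact ⟨t, ht, by simp only [smul_add, smul_sub, smul_comm c t]⟩
    · rw [openSegment_eq_image'] at hp' ⊢
      obtain ⟨t, ht, rfl⟩ := hp'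
      exact ⟨t, ht, by simp only [smul_add, smul_sub, smul_comm c t]⟩
  have hpi : (2 * Real.pi * I : ℂ) ≠ 0 := by simp [Real.pi_ne_zero, I_ne_zero]
  rcases segSide_halfDiag_dartPt hv with ⟨h0, h1⟩ | ⟨h0, h1⟩
  · rw [Path.crossInc_segment_of_cross (by rw [segSide_smul]; positivity)
      (by rw [segSide_smul]; exact mul_neg_of_pos_of_neg hc2 h1) hx]
    exact hpi
  · rw [Path.crossInc_segment_of_cross' (by rw [segSide_smul]; exact mul_neg_of_pos_of_neg hc2 h0)
      (by rw [segSide_smul]; positivity) hx]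
    exact neg_ne_zero.2 hpi

end Literature.Probability.LatticeModels
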